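import Summits.CriticalPhenomena.Ising3D.TaylorRegionCheckEJ
import Mathlib.Tactic.Linarith
import Mathlib.Tactic.Positivity
import Mathlib.Tactic.Ring
import HarnessLib

/-!
# HYBRID region checks: exact per-integer-`j` polynomials in `E` on the bounded part, `(E, θ)` tail beyond `E₁`
(cell `pub-ising3x`, seat recog-1 gen 11; gate (g2) — the design the measurements dictate)

HONEST FRAMING: lottery ticket; floor = tightest certified 3D Ising CFT bounds; no exact-solution
claim without a proof.

MEASURED on a real Λ = 11 functional (HOME/pub-ising3x-recog-1/gen11/measure): on `E ∈ [40, 300]` every q-sum varies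
over ~10 orders of magnitude and its `E`-power columns alternate in sign, so enclosing the `θ = j/E` dependence over
θ-cells (as `TaylorRegionCheckEJ` does everywhere) loses the bounded part to interval slack, while the shifted-sign
TAIL test at `E₁ ≈ 300` passes. Hence the hybrid: for `E ≥ E₁` the `(E, θ)` table and `halfStripPos2` (box part
vacuous); for `E₀ ≤ E < E₁` every INTEGER `j ≤ J₁` (`E₁ ≤ J₁ + 1`) separately, with the EXACT univariate interval
polynomial `qSumListLI` of `TaylorQPolyIntervalList` (coefficient widths only from the `(Δσ, Δε)`-box) and the
tree's `posOn` on `[max(E₀, j), E₁]`. Results: `EvenRegionDataH.check = true → TaylorEvenRegion …`,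
`OddConeRegionDataH.check = true →` the `odd_cone` field — conclusions identical to the EJ / kernel-route files
(so `TaylorTable` glue is a one-liner, `TaylorRegionCertsH`). SUFFICIENT (interval slack only). Elementary. [folklore]
-/

namespace Summit.CriticalPhenomena.Ising3D

open Finset Set
open Literature.Analysis.ValidatedNumerics Literature.Analysis.ValidatedNumerics.PolyMP
open Literature.Analysis.ValidatedNumerics.NumericsMP (MI)
open Literature.MathematicalPhysics.QuantumFieldTheory.ConformalBootstrap3D

/-! ### Per-`j` univariate interval polynomials -/

/-- The univariate (in `E`) interval polynomial of the component `(cQ, s ∈ sI, σQ)` at integer `j`. [folklore] -/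
def qRowI (S : ℕ) (cQ : ℕ × ℕ → ℚ) (σQ : ℚ) (sI : MI) (l : List (ℕ × ℕ)) (j : ℕ) : IPoly :=
  qSumListLI S cQ σQ (signedChooseI S sI) l j

/-- Its real shadow. [folklore] -/
noncomputable def qRow (cQ : ℕ × ℕ → ℚ) (σQ : ℚ) (s : ℝ) (l : List (ℕ × ℕ)) (j : ℕ) : List ℝ :=
  qSumListL (fun ab => (cQ ab : ℝ)) l s (σQ : ℝ) j

/-- [folklore] -/
theorem pmem_qRowI {S : ℕ} (hS : 0 < S) (cQ : ℕ × ℕ → ℚ) (σQ : ℚ) {s : ℝ} {sI : MI} (hs : MI.mem S s sI)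
    (l : List (ℕ × ℕ)) (j : ℕ) : PMem S (qRow cQ σQ s l j) (qRowI S cQ σQ sI l j) :=
  pmem_qSumListLI hS cQ σQ l j fun _ _ i _ => mem_signedChooseI hS hs i

/-- [folklore] -/
theorem qSum_eq_evalR_qRow (cQ : ℕ × ℕ → ℚ) (σQ : ℚ) (s : ℝ) {l : List (ℕ × ℕ)} (hl : l.Nodup) (j : ℕ) (E : ℝ) :
    qSum (fun ab => (cQ ab : ℝ)) l.toFinset s (σQ : ℝ) E j = evalR (qRow cQ σQ s l j) E :=
  (evalR_qSumListL _ hl s _ j E).symm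

/-- `posOn` on `[max(E₀, j), E₁]`, skipped when that interval is empty. [folklore] -/
def rowPos (S dP : ℕ) (P : IPoly) (E0 E1 : ℚ) (j : ℕ) : Bool :=
  decide (E1 < max E0 (j : ℚ)) || posOn S dP P (max E0 (j : ℚ)) E1

/-- [folklore] -/
theorem pos_of_rowPos {S : ℕ} (hS : 0 < S) {dP : ℕ} {P : IPoly} {E0 E1 : ℚ} {j : ℕ} (h : rowPos S dP P E0 E1 j = true)
    {as : List ℝ} (has : PMem S as P) {E : ℝ} (hE0 : (E0 : ℝ) ≤ E) (hjE : (j : ℝ) ≤ E) (hE1 : E ≤ E1) :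
    0 < evalR as E := by
  simp only [rowPos, Bool.or_eq_true, decide_eq_true_eq] at h
  have hlo : ((max E0 (j : ℚ) : ℚ) : ℝ) ≤ E := by push_cast; exact max_le hE0 hjE
  rcases h with hvac | hpos
  · exfalso
    have : ((E1 : ℚ) : ℝ) < ((max E0 (j : ℚ) : ℚ) : ℝ) := by exact_mod_cast hvac
    linarith
  · have hle : max E0 (j : ℚ) ≤ E1 := by
      have : ((max E0 (j : ℚ) : ℚ) : ℝ) ≤ (E1 : ℝ) := hlo.trans hE1
      exact_mod_cast this
    exact posOn_sound hS hpos hle has hlo hE1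

/-! ### Even sector, hybrid -/

/-- Data of a hybrid even-region check. [folklore] -/
structure EvenRegionDataH where
  S : ℕ
  l : List (ℕ × ℕ)
  cQ : Fin 5 → ℕ × ℕ → ℚ
  sσI : MI
  sεI : MI
  sbI : MI
  /-- thresholds: region from `E₀`; tail table from `E₁`; integers `j ≤ J₁` on the bounded part -/
  E0 : ℚ
  E1 : ℚ
  J1 : ℕ
  /-- `(E, θ)` tail tables: centre, row count, moment length, checker parameters -/
  ccQ : ℚ
  N : ℕ
  R : ℕ
  prmX : HSParams
  prmY : HSParams
  prmD : HSParams
  /-- `posOn` depth for the per-`j` rows -/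
  dPj : ℕ

namespace EvenRegionDataH

/-- [folklore] -/
def TX (d : EvenRegionDataH) : IPoly2 := momTableI d.S (d.cQ 0) (-1) d.sσI d.ccQ d.l d.N d.R
/-- [folklore] -/
def TY (d : EvenRegionDataH) : IPoly2 := momTableI d.S (d.cQ 1) (-1) d.sεI d.ccQ d.l d.N d.R
/-- [folklore] -/
def TZ (d : EvenRegionDataH) : IPoly2 :=
  add2I (momTableI d.S (d.cQ 3) (-1) d.sbI d.ccQ d.l d.N d.R) (momTableI d.S (d.cQ 4) 1 d.sbI d.ccQ d.l d.N d.R)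
/-- [folklore] -/
def TD (d : EvenRegionDataH) : IPoly2 := add2I (smul2QI 4 (mul2I d.S d.TX d.TY)) (neg2I (mul2I d.S d.TZ d.TZ))
/-- per-`j` rows -/
def RX (d : EvenRegionDataH) (j : ℕ) : IPoly := qRowI d.S (d.cQ 0) (-1) d.sσI d.l j
/-- [folklore] -/
def RY (d : EvenRegionDataH) (j : ℕ) : IPoly := qRowI d.S (d.cQ 1) (-1) d.sεI d.l j
/-- [folklore] -/
def RZ (d : EvenRegionDataH) (j : ℕ) : IPoly := addI (qRowI d.S (d.cQ 3) (-1) d.sbI d.l j) (qRowI d.S (d.cQ 4) 1 d.sbI d.l j)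
/-- [folklore] -/
def RD (d : EvenRegionDataH) (j : ℕ) : IPoly :=
  addI (smulQI 4 (mulI d.S (d.RX j) (d.RY j))) (smulIntI (-1) (mulI d.S (d.RZ j) (d.RZ j)))

/-- **The hybrid even-region check.** [folklore] -/
def check (d : EvenRegionDataH) : Bool :=
  decide (0 < d.S) && decide (0 < d.E0) && decide (d.E1 ≤ (d.J1 : ℚ) + 1) && momLenOK d.N d.R &&
  kernelSizeOK d.S (d.cQ 0) (-1) d.sσI d.ccQ d.l d.N && kernelSizeOK d.S (d.cQ 1) (-1) d.sεI d.ccQ d.l d.N &&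
  kernelSizeOK d.S (d.cQ 3) (-1) d.sbI d.ccQ d.l d.N && kernelSizeOK d.S (d.cQ 4) 1 d.sbI d.ccQ d.l d.N &&
  decide (1 ≤ d.prmX.θhi) && decide (1 ≤ d.prmY.θhi) && decide (1 ≤ d.prmD.θhi) &&
  halfStripPos2 d.S d.TX (d.E1 - d.ccQ) d.prmX && halfStripPos2 d.S d.TY (d.E1 - d.ccQ) d.prmY &&
  halfStripPos2 d.S d.TD (d.E1 - d.ccQ) d.prmD &&
  (List.range (d.J1 + 1)).all fun j =>
    rowPos d.S d.dPj (d.RX j) d.E0 d.E1 j && rowPos d.S d.dPj (d.RY j) d.E0 d.E1 j && rowPos d.S d.dPj (d.RD j) d.E0 d.E1 j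

end EvenRegionDataH

/-- **The even region from the hybrid check.** [folklore] -/
theorem taylorEvenRegion_of_evenRegionCheckH (d : EvenRegionDataH) (hl : d.l.Nodup) (Q : Set (ℝ × ℝ))
    (hQ : ∀ p ∈ Q, MI.mem d.S p.1 d.sσI ∧ MI.mem d.S p.2 d.sεI ∧ MI.mem d.S ((p.1 + p.2) / 2) d.sbI)
    (h : d.check = true) :
    TaylorEvenRegion (taylorCrossing (1 / 2) (1 / 2) d.l.toFinset fun i ab => (d.cQ i ab : ℝ)) Q ((d.E0 : ℚ) : ℝ) := by
  simp only [EvenRegionDataH.check, Bool.and_eq_true, decide_eq_true_eq] at h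
  obtain ⟨⟨⟨⟨⟨⟨⟨⟨⟨⟨⟨⟨⟨⟨hS, hE0⟩, hJ1⟩, hR⟩, hN0⟩, hN1⟩, hN3⟩, hN4⟩, hθX⟩, hθY⟩, hθD⟩, hX⟩, hY⟩, hD⟩, hrows⟩ := h
  refine taylorEvenRegion_half_of_qRegion _ _ Q _ fun p hp E j hE hj => ?_
  obtain ⟨hsσ, hsε, hsb⟩ := hQ p hp
  have hEpos : 0 < E := lt_of_lt_of_le (by exact_mod_cast hE0) hE
  by_cases hE1 : ((d.E1 : ℚ) : ℝ) ≤ E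
  · -- tail: (E, θ) tables from E₁ on
    have hθ := div_mem_unit hEpos hj
    have hP : ((d.E1 - d.ccQ : ℚ) : ℝ) ≤ E - d.ccQ := by push_cast; linarith
    have eX := qSum_eq_eval2_momTable hS (d.cQ 0) (-1) hsσ d.ccQ hl hN0 hR hEpos j
    have eY := qSum_eq_eval2_momTable hS (d.cQ 1) (-1) hsε d.ccQ hl hN1 hR hEpos j
    have eZ3 := qSum_eq_eval2_momTable hS (d.cQ 3) (-1) hsb d.ccQ hl hN3 hR hEpos j
    have eZ4 := qSum_eq_eval2_momTable hS (d.cQ 4) 1 hsb d.ccQ hl hN4 hR hEpos j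
    have pX := pmem2_momTableI hS (d.cQ 0) (-1) hsσ d.ccQ d.l d.N d.R
    have pY := pmem2_momTableI hS (d.cQ 1) (-1) hsε d.ccQ d.l d.N d.R
    have pZ := pmem2_add2I (pmem2_momTableI hS (d.cQ 3) (-1) hsb d.ccQ d.l d.N d.R)
      (pmem2_momTableI hS (d.cQ 4) 1 hsb d.ccQ d.l d.N d.R)
    have pD := pmem2_add2I (pmem2_smul2QI (4 : ℚ) (r := 4) (by norm_num) (pmem2_mul2I hS pX pY))
      (pmem2_neg2I (pmem2_mul2I hS pZ pZ))
    have vX := halfStripPos2_sound hS pX hX hP hθ.1 (hθ.2.trans (by exact_mod_cast hθX))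
    have vY := halfStripPos2_sound hS pY hY hP hθ.1 (hθ.2.trans (by exact_mod_cast hθY))
    have vD := halfStripPos2_sound hS pD hD hP hθ.1 (hθ.2.trans (by exact_mod_cast hθD))
    rw [eval2_add2, eval2_smul2, eval2_mul2, eval2_smul2, eval2_mul2, eval2_add2] at vD
    simp only [Rat.cast_neg, Rat.cast_one] at eX eY eZ3 eZ4
    have goalD : (qSum (fun ab => (d.cQ 3 ab : ℝ)) d.l.toFinset ((p.1 + p.2) / 2) (-1) E j +
        qSum (fun ab => (d.cQ 4 ab : ℝ)) d.l.toFinset ((p.1 + p.2) / 2) 1 E j) ^ 2 ≤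
        4 * qSum (fun ab => (d.cQ 0 ab : ℝ)) d.l.toFinset p.1 (-1) E j *
          qSum (fun ab => (d.cQ 1 ab : ℝ)) d.l.toFinset p.2 (-1) E j := by
      rw [eX, eY, eZ3, eZ4, sq]; linarith
    exact ⟨by rw [eX]; exact vX.le, by rw [eY]; exact vY.le, goalD⟩
  · -- bounded part: exact row at the integer j
    have hElt : E < d.E1 := lt_of_not_ge hE1
    have hjJ : j < d.J1 + 1 := by
      have h1 : (j : ℝ) < (d.J1 : ℝ) + 1 := by
        have : ((d.E1 : ℚ) : ℝ) ≤ (d.J1 : ℝ) + 1 := by exact_mod_cast hJ1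
        linarith
      exact_mod_cast h1
    have hrow := List.all_eq_true.mp hrows j (List.mem_range.mpr hjJ)
    simp only [Bool.and_eq_true] at hrow
    obtain ⟨⟨rX, rY⟩, rD⟩ := hrow
    have pX := pmem_qRowI hS (d.cQ 0) (-1) hsσ d.l j
    have pY := pmem_qRowI hS (d.cQ 1) (-1) hsε d.l j
    have pZ := pmem_addI (pmem_qRowI hS (d.cQ 3) (-1) hsb d.l j) (pmem_qRowI hS (d.cQ 4) 1 hsb d.l j)
    have pD := pmem_addI (pmem_smulQI (4 : ℚ) (r := 4) (by norm_num) (pmem_mulI hS pX pY))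
      (pmem_smulIntI (-1 : ℤ) (pmem_mulI hS pZ pZ))
    have vX := pos_of_rowPos hS rX pX hE hj hElt.le
    have vY := pos_of_rowPos hS rY pY hE hj hElt.le
    have vD := pos_of_rowPos hS rD pD hE hj hElt.le
    rw [evalR_addR, evalR_smulR, evalR_mulR, evalR_smulR, evalR_mulR, evalR_addR] at vD
    have eX := qSum_eq_evalR_qRow (d.cQ 0) (-1) p.1 hl j E
    have eY := qSum_eq_evalR_qRow (d.cQ 1) (-1) p.2 hl j E
    have eZ3 := qSum_eq_evalR_qRow (d.cQ 3) (-1) ((p.1 + p.2) / 2) hl j E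
    have eZ4 := qSum_eq_evalR_qRow (d.cQ 4) 1 ((p.1 + p.2) / 2) hl j E
    simp only [Rat.cast_neg, Rat.cast_one] at eX eY eZ3 eZ4
    simp only [Int.cast_neg, Int.cast_one] at vD
    have goalD : (qSum (fun ab => (d.cQ 3 ab : ℝ)) d.l.toFinset ((p.1 + p.2) / 2) (-1) E j +
        qSum (fun ab => (d.cQ 4 ab : ℝ)) d.l.toFinset ((p.1 + p.2) / 2) 1 E j) ^ 2 ≤
        4 * qSum (fun ab => (d.cQ 0 ab : ℝ)) d.l.toFinset p.1 (-1) E j *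
          qSum (fun ab => (d.cQ 1 ab : ℝ)) d.l.toFinset p.2 (-1) E j := by
      rw [eX, eY, eZ3, eZ4, sq]; linarith
    exact ⟨by rw [eX]; exact vX.le, by rw [eY]; exact vY.le, goalD⟩

/-! ### Odd cone, hybrid -/

/-- Data of a hybrid odd-cone check. [folklore] -/
structure OddConeRegionDataH where
  S : ℕ
  l : List (ℕ × ℕ)
  cQ : Fin 5 → ℕ × ℕ → ℚ
  lψ : List (ℕ × ℕ)
  ψQ : ℕ × ℕ → ℚ
  κ₀Q : ℚ
  sσI : MI
  sbI : MI
  stI : MI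
  K1 : MI
  K2 : MI
  K3 : MI
  E0 : ℚ
  E1 : ℚ
  J1 : ℕ
  ccQ : ℚ
  N : ℕ
  R : ℕ
  prmM1 : HSParams
  prmM2 : HSParams
  prmR1 : HSParams
  prmR2 : HSParams
  dPj : ℕ

namespace OddConeRegionDataH

/-- the EJ tail data -/
def tail (d : OddConeRegionDataH) : OddConeRegionDataEJ where
  S := d.S
  l := d.l
  cQ := d.cQ
  lψ := d.lψ
  ψQ := d.ψQ
  κ₀Q := d.κ₀Q
  sσI := d.sσI
  sbI := d.sbI
  stI := d.stI
  K1 := d.K1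
  K2 := d.K2
  K3 := d.K3
  ccQ := d.ccQ
  P0 := d.E1 - d.ccQ
  N := d.N
  R := d.R
  prmM1 := d.prmM1
  prmM2 := d.prmM2
  prmR1 := d.prmR1
  prmR2 := d.prmR2
/-- per-`j` rows -/
def R3 (d : OddConeRegionDataH) (j : ℕ) : IPoly := qRowI d.S (d.cQ 2) (-1) d.sbI d.l j
/-- [folklore] -/
def R4 (d : OddConeRegionDataH) (j : ℕ) : IPoly := qRowI d.S (d.cQ 3) (-1) d.sσI d.l j
/-- [folklore] -/
def R5 (d : OddConeRegionDataH) (j : ℕ) : IPoly := qRowI d.S (d.cQ 4) 1 d.sσI d.l j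
/-- [folklore] -/
def Rψ0 (d : OddConeRegionDataH) (j : ℕ) : IPoly := qRowI d.S d.ψQ 0 (MI.ofInt d.S 0) d.lψ j
/-- [folklore] -/
def Rψt (d : OddConeRegionDataH) (j : ℕ) : IPoly := qRowI d.S d.ψQ 0 d.stI d.lψ j
/-- [folklore] -/
def RM (d : OddConeRegionDataH) (ε : ℤ) (j : ℕ) : IPoly :=
  addI (d.Rψ0 j) (smulQI (-(ε : ℚ)) (smulI d.S d.K1 (d.R3 j)))
/-- [folklore] -/
def RR (d : OddConeRegionDataH) (ε : ℤ) (j : ℕ) : IPoly :=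
  addI (addI (d.R4 j) (smulIntI (-1) (d.R5 j)))
    (addI (smulQI (-(ε : ℚ) * (d.κ₀Q / 2)) (smulI d.S d.K2 (d.R3 j))) (smulQI (-(d.κ₀Q⁻¹ / 2)) (smulI d.S d.K3 (d.Rψt j))))

/-- **The hybrid odd-cone check.** [folklore] -/
def check (d : OddConeRegionDataH) : Bool :=
  decide (0 < d.E0) && decide (d.E1 ≤ (d.J1 : ℚ) + 1) && d.tail.check &&
  (List.range (d.J1 + 1)).all fun j =>
    rowPos d.S d.dPj (d.RM 1 j) d.E0 d.E1 j && rowPos d.S d.dPj (d.RM (-1) j) d.E0 d.E1 j &&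
    rowPos d.S d.dPj (d.RR 1 j) d.E0 d.E1 j && rowPos d.S d.dPj (d.RR (-1) j) d.E0 d.E1 j

end OddConeRegionDataH

/-- **The odd cone from the hybrid check** (the `odd_cone` field shape, `E_T = E₀`, `κ₀ = κ₀Q`). [folklore] -/
theorem oddCone_of_oddConeRegionCheckH (d : OddConeRegionDataH) (hl : d.l.Nodup) (hlψ : d.lψ.Nodup)
    (Q : Set (ℝ × ℝ))
    (hQ : ∀ p ∈ Q, MI.mem d.S p.1 d.sσI ∧ MI.mem d.S ((p.1 + p.2) / 2) d.sbI ∧ MI.mem d.S (p.1 - p.2) d.stI ∧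
      MI.mem d.S ((1 / 2 : ℝ) ^ (p.1 + p.2)) d.K1 ∧ MI.mem d.S ((1 / 2 : ℝ) ^ (p.2 - p.1)) d.K2 ∧
      MI.mem d.S ((1 / 2 : ℝ) ^ (-(2 * p.2))) d.K3)
    (h : d.check = true) :
    ∀ p ∈ Q, ∀ (E : ℝ) (j : ℕ), ((d.E0 : ℚ) : ℝ) ≤ E → (j : ℝ) ≤ E →
      OddConeAt (taylorCrossing (1 / 2) (1 / 2) d.l.toFinset fun i ab => (d.cQ i ab : ℝ))
        (∑ ab ∈ d.lψ.toFinset, (d.ψQ ab : ℝ) • taylorCoeffAt (1 / 2) (1 / 2) ab) (d.κ₀Q : ℝ) p.1 p.2 E j := by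
  simp only [OddConeRegionDataH.check, Bool.and_eq_true, decide_eq_true_eq] at h
  obtain ⟨⟨⟨hE0, hJ1⟩, htail⟩, hrows⟩ := h
  intro p hp E j hE hj
  by_cases hE1 : ((d.E1 : ℚ) : ℝ) ≤ E
  · have ht := oddCone_of_oddConeRegionCheckEJ d.tail hl hlψ Q hQ htail p hp E j
    simp only [OddConeRegionDataH.tail, sub_add_cancel] at ht
    exact ht hE1 hj
  · obtain ⟨hsσ, hsb, hst, hK1, hK2, hK3⟩ := hQ p hp
    have hS : 0 < d.S := by
      have := htail; simp only [OddConeRegionDataEJ.check, Bool.and_eq_true, decide_eq_true_eq] at this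
      exact this.1.1.1.1.1.1.1.1.1.1.1.1.1.1.1.1
    have hκ₀ : 0 < d.κ₀Q := by
      have := htail; simp only [OddConeRegionDataEJ.check, Bool.and_eq_true, decide_eq_true_eq] at this
      exact this.1.1.1.1.1.1.1.1.1.1.1.1.1.1.1.2
    have hElt : E < d.E1 := lt_of_not_ge hE1
    have hjJ : j < d.J1 + 1 := by
      have h1 : (j : ℝ) < (d.J1 : ℝ) + 1 := by
        have : ((d.E1 : ℚ) : ℝ) ≤ (d.J1 : ℝ) + 1 := by exact_mod_cast hJ1
        linarith
      exact_mod_cast h1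
    have hrow := List.all_eq_true.mp hrows j (List.mem_range.mpr hjJ)
    simp only [Bool.and_eq_true] at hrow
    obtain ⟨⟨⟨rM1, rM2⟩, rR1⟩, rR2⟩ := hrow
    have h0mem : MI.mem d.S (0 : ℝ) (MI.ofInt d.S 0) := by simpa using MI.mem_ofInt d.S 0
    have p3 := pmem_qRowI hS (d.cQ 2) (-1) hsb d.l j
    have p4 := pmem_qRowI hS (d.cQ 3) (-1) hsσ d.l j
    have p5 := pmem_qRowI hS (d.cQ 4) 1 hsσ d.l j
    have pψ0 := pmem_qRowI hS d.ψQ 0 h0mem d.lψ j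
    have pψt := pmem_qRowI hS d.ψQ 0 hst d.lψ j
    have pM : ∀ ε : ℤ, PMem d.S (addR (qRow d.ψQ 0 0 d.lψ j)
        (smulR (-(ε : ℝ)) (smulR ((1 / 2 : ℝ) ^ (p.1 + p.2)) (qRow (d.cQ 2) (-1) ((p.1 + p.2) / 2) d.l j))))
        (d.RM ε j) := fun ε =>
      pmem_addI pψ0 (pmem_smulQI _ (by push_cast; ring) (pmem_smulI hS hK1 p3))
    have pR : ∀ ε : ℤ, PMem d.S
        (addR (addR (qRow (d.cQ 3) (-1) p.1 d.l j) (smulR ((-1 : ℤ) : ℝ) (qRow (d.cQ 4) 1 p.1 d.l j)))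
          (addR (smulR (-(ε : ℝ) * ((d.κ₀Q : ℝ) / 2)) (smulR ((1 / 2 : ℝ) ^ (p.2 - p.1)) (qRow (d.cQ 2) (-1) ((p.1 + p.2) / 2) d.l j)))
            (smulR (-((d.κ₀Q : ℝ)⁻¹ / 2)) (smulR ((1 / 2 : ℝ) ^ (-(2 * p.2))) (qRow d.ψQ 0 (p.1 - p.2) d.lψ j)))))
        (d.RR ε j) := fun ε =>
      pmem_addI (pmem_addI p4 (pmem_smulIntI (-1 : ℤ) p5))
        (pmem_addI (pmem_smulQI _ (by push_cast; ring) (pmem_smulI hS hK2 p3))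
          (pmem_smulQI _ (by push_cast; ring) (pmem_smulI hS hK3 pψt)))
    have vM1 := pos_of_rowPos hS rM1 (pM 1) hE hj hElt.le
    have vM2 := pos_of_rowPos hS rM2 (pM (-1)) hE hj hElt.le
    have vR1 := pos_of_rowPos hS rR1 (pR 1) hE hj hElt.le
    have vR2 := pos_of_rowPos hS rR2 (pR (-1)) hE hj hElt.le
    simp only [evalR_addR, evalR_smulR, Int.cast_one, Int.cast_neg] at vM1 vM2 vR1 vR2
    have e3 := qSum_eq_evalR_qRow (d.cQ 2) (-1) ((p.1 + p.2) / 2) hl j E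
    have e4 := qSum_eq_evalR_qRow (d.cQ 3) (-1) p.1 hl j E
    have e5 := qSum_eq_evalR_qRow (d.cQ 4) 1 p.1 hl j E
    have eψ0 := qSum_eq_evalR_qRow d.ψQ 0 0 hlψ j E
    have eψt := qSum_eq_evalR_qRow d.ψQ 0 (p.1 - p.2) hlψ j E
    simp only [Rat.cast_neg, Rat.cast_one, Rat.cast_zero] at e3 e4 e5 eψ0 eψt
    rw [← e3, ← eψ0] at vM1 vM2
    rw [← e3, ← e4, ← e5, ← eψt] at vR1 vR2
    have hκ₁ : 0 ≤ (1 / 2 : ℝ) ^ (p.1 + p.2) := (Real.rpow_pos_of_pos (by norm_num) _).le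
    have hκ₂ : 0 ≤ (1 / 2 : ℝ) ^ (p.2 - p.1) := (Real.rpow_pos_of_pos (by norm_num) _).le
    have hκ₀R : (0 : ℝ) < (d.κ₀Q : ℝ) := by exact_mod_cast hκ₀
    refine oddConeAt_half_of_qCone _ _ _ _ _ p.1 p.2 E j hj ?_ ?_
    · rw [← abs_of_nonneg hκ₁, ← abs_mul, abs_le]
      constructor <;> linarith
    · have hc : 0 ≤ (d.κ₀Q : ℝ) / 2 * (1 / 2 : ℝ) ^ (p.2 - p.1) := by positivity
      rcases le_total 0 (qSum (fun ab => (d.cQ 2 ab : ℝ)) d.l.toFinset ((p.1 + p.2) / 2) (-1) E j) with h3 | h3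
      · rw [abs_of_nonneg h3]; linarith
      · rw [abs_of_nonpos h3]
        have := mul_nonneg hc (neg_nonneg.mpr h3)
        nlinarith

end Summit.CriticalPhenomena.Ising3D
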